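import Summits.QuantumFields.YangMills.Theorems.SteinGapBootstrapFreeProbeLawGAssemblyGen
import Summits.QuantumFields.YangMills.Theorems.SteinGapBootstrapFreeProbeLawGAssemblyPair
import Summits.QuantumFields.YangMills.Theorems.SteinGapBootstrapFreeProbeLawGSteinPair
import Summits.QuantumFields.YangMills.Theorems.SteinGapBootstrapFreeProbeLawGTestFun
import HarnessLib

/-!
# Crux U `FreeProbeLawG` (stmt-QuantumFields-23756), line `birth` — assembly part A3d(i): the background bound per block plaquette

Lead `ym-line-sgb-k1-g1`; helper toward the registered stub `stub_assembly`. All inputs of the line at a fixed inverse coupling `β ≥ 1`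
and a fixed torus-limit state `μ` — the single-edge Schwinger–Dyson identities with rate (stub `stub_sdRate`), the truncated Green `1`-forms
(stub `stub_blockGreen`), the field bounds (stub `stub_fieldBounds`) and the sharp budget (stub `stub_budgetRate`) — are combined, for a
truncation radius `R ≥ 2n + 2`, a Gaussian-weight scale `0 < δ ≤ 1` and an AM–GM parameter `λ > 0`, into an explicit bound on the
Ornstein–Uhlenbeck generator discrepancy of the pair law (`raw_bound`): boxes `E ⊆ edges`, `S ⊆ plaquettes` of radius `R`, `R+1`
(`Resum`), the resummed SD identity (`AssemblyCore`), the Stein pair (`AssemblyPair` with the test functions of `TestFun`), the abstract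
Stein-pair budget lemma (`SteinPair`) and the generator step (`AssemblyGen`). The choice of `R, δ, λ` as powers of `β` is made in the final
file. HONEST LABEL: RECORD rung R2ξ-G only; nothing here bears on the Yang–Mills mass gap.
References: E. Meckes, IMS Coll. 5 (2009), Lemma 1 [Meckes2009]; S. Chatterjee, arXiv:1602.01222, §11 [arXiv160201222].
-/

set_option autoImplicit false

noncomputable section

open MeasureTheory Finset
open Literature.Probability.LatticeModels Literature.MathematicalPhysics.QuantumLattice
open Literature.MathematicalPhysics.QuantumFieldTheory hiding ZdEdge IsLocalObservable IsInfiniteVolumeLimit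
open Summit.QuantumFields.YangMills.Theorems.EquipartitionPinsProbe

namespace Summit.QuantumFields.YangMills.Cruxes.FreeProbeLawG.SteinFree

namespace AssemblyBackground

variable {G : Type} [Group G] [TopologicalSpace G] [IsTopologicalGroup G] [CompactSpace G]
  [MeasurableSpace G] [BorelSpace G] [SecondCountableTopology G]

/-- Weighted Cauchy–Schwarz: `(Σ c_q y_q)² ≤ (Σ |c_q|) · Σ |c_q| y_q²`. -/
theorem sq_sum_mul_le {ι : Type*} (s : Finset ι) (c y : ι → ℝ) :
    (∑ q ∈ s, c q * y q) ^ 2 ≤ (∑ q ∈ s, |c q|) * ∑ q ∈ s, |c q| * (y q) ^ 2 := by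
  have h1 : |∑ q ∈ s, c q * y q| ≤ ∑ q ∈ s, Real.sqrt |c q| * (Real.sqrt |c q| * |y q|) := by
    refine (Finset.abs_sum_le_sum_abs _ _).trans (Finset.sum_le_sum fun q _ => ?_)
    rw [abs_mul, ← mul_assoc, Real.mul_self_sqrt (abs_nonneg _)]
  have h2 := Finset.sum_mul_sq_le_sq_mul_sq s (fun q => Real.sqrt |c q|) (fun q => Real.sqrt |c q| * |y q|)
  have h3 : ∑ q ∈ s, Real.sqrt |c q| ^ 2 = ∑ q ∈ s, |c q| :=
    Finset.sum_congr rfl fun q _ => Real.sq_sqrt (abs_nonneg _)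
  have h4 : ∑ q ∈ s, (Real.sqrt |c q| * |y q|) ^ 2 = ∑ q ∈ s, |c q| * (y q) ^ 2 :=
    Finset.sum_congr rfl fun q _ => by rw [mul_pow, Real.sq_sqrt (abs_nonneg _), sq_abs]
  rw [h3, h4] at h2
  have h0 : 0 ≤ ∑ q ∈ s, Real.sqrt |c q| * (Real.sqrt |c q| * |y q|) := Finset.sum_nonneg fun q _ => by positivity
  calc (∑ q ∈ s, c q * y q) ^ 2 = |∑ q ∈ s, c q * y q| ^ 2 := (sq_abs _).symm
    _ ≤ (∑ q ∈ s, Real.sqrt |c q| * (Real.sqrt |c q| * |y q|)) ^ 2 := pow_le_pow_left₀ (abs_nonneg _) h1 2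
    _ ≤ _ := h2


/-- **The harmonic background of a block plaquette is small in `L¹`** (Stein pair + budget): the per-plaquette step of `raw_bound`. -/
theorem background_bound (r : LatticeRep G) {β : ℝ} (hβ0 : 0 < β) (μ : Measure (LGConfig 4 G)) [IsProbabilityMeasure μ]
    (S : Finset (ZdPlaquette 4)) (E : Finset (ZdEdge 4)) (ωp : ZdEdge 4 → ℝ) (hωE : ∀ e, ωp e ≠ 0 → e ∈ E)
    (p : ZdPlaquette 4) (hpS : p ∈ S)
    {εsd : ℝ} (hε : 0 ≤ εsd)
    (hSD' : ∀ (a : Fin (lieDim r)), ∀ e ∈ E, ∀ (g : (↥S → Fin (lieDim r) → ℝ) → ℝ) (M : ℝ), 0 ≤ M → ContDiff ℝ 1 g →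
      (∀ y, |g y| ≤ 1) → (∀ y, ‖fderiv ℝ g y‖ ≤ M) →
      |(∑ p' : ↥S, plaquetteCurl (fun e' => if e' = e then (1 : ℝ) else 0) (p' : ZdPlaquette 4) *
            ∫ U, fderiv ℝ g (fun q b => plaqField r β U (q : ZdPlaquette 4) b)
              (fun q b => if q = p' ∧ b = a then (1 : ℝ) else 0) ∂μ) -
          ∫ U, g (fun q b => plaqField r β U (q : ZdPlaquette 4) b) *
            (∑ p' ∈ S, plaquetteCurl (fun e' => if e' = e then (1 : ℝ) else 0) p' * plaqField r β U p' a) ∂μ| ≤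
        εsd * (1 + M))
    {W : ℝ} (hW : ∑ e ∈ E, |ωp e| ≤ W) (hW0 : 0 ≤ W)
    {s : ℝ} (hs0 : 0 ≤ s) (hcp : plaquetteCurl ωp p = s)
    {Δb : ℝ} (hΔb : |(∑ q ∈ S, (plaquetteCurl ωp q) ^ 2) - s| ≤ Δb)
    {Cc : ℝ} (hCc0 : 0 ≤ Cc) (hcsum : ∑ q ∈ S, |plaquetteCurl ωp q| ≤ Cc)
    {Y2 : ℝ} (hY2 : ∀ q ∈ S, ∀ a : Fin (lieDim r),
      Integrable (fun U => (plaqField r β U q a) ^ 2) μ ∧ ∫ U, (plaqField r β U q a) ^ 2 ∂μ ≤ Y2)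
    {εb : ℝ} (hbudget : ∫ U, ∑ a : Fin (lieDim r), (plaqField r β U p a) ^ 2 ∂μ ≤ (lieDim r : ℝ) * s + εb)
    {δ : ℝ} (hδ : 0 < δ) (hδ1 : δ ≤ 1) {lam : ℝ} (hlam : 0 < lam) (a₀ : Fin (lieDim r)) :
    ∫ U, |plaqField r β U p a₀ - ∑ q ∈ S, plaquetteCurl ωp q * plaqField r β U q a₀| ∂μ ≤
      lam * (εb + 3 * (lieDim r : ℝ) * (W * (εsd * (δ ^ (-(1 / 2 : ℝ)) + ((lieDim r : ℝ) + 2) * (1 + Cc))) + 3 * Δb) +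
          s * δ * ((lieDim r : ℝ) * Y2 * (2 + 3 * Cc ^ 2)) * ((lieDim r : ℝ) / 2 + 1)) + lam⁻¹ +
        Real.sqrt δ * ((lieDim r : ℝ) * Y2 * (2 + 3 * Cc ^ 2)) := by
  classical
  have _hβ := hβ0
  have hint : ∀ {f : LGConfig 4 G → ℝ}, Continuous f → Integrable f μ := fun hf =>
    AssemblyCore.integrable_of_continuous_bdd μ hf
  have hYqc : ∀ (q : ZdPlaquette 4) (a : Fin (lieDim r)), Continuous fun U : LGConfig 4 G => plaqField r β U q a :=
    fun q a => TangentPlaqFieldContinuous.continuous_plaqField_apply r β q a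
  set η : ℝ := W * (εsd * (δ ^ (-(1 / 2 : ℝ)) + ((lieDim r : ℝ) + 2) * (1 + Cc))) + 3 * Δb with hηdef
  set Λ : ℝ := (lieDim r : ℝ) * Y2 * (2 + 3 * Cc ^ 2) with hΛdef
  -- the pair (X, Z) and the weight
  set Zf : Fin (lieDim r) → LGConfig 4 G → ℝ := fun a U => ∑ q ∈ S, plaquetteCurl ωp q * plaqField r β U q a
    with hZfdef
  set Xf : Fin (lieDim r) → LGConfig 4 G → ℝ := fun a U => plaqField r β U p a - Zf a U with hXfdef
  set w : LGConfig 4 G → ℝ := fun U => Real.exp (-(δ / 2) * ∑ b, ((Xf b U) ^ 2 + (Zf b U) ^ 2)) with hwdef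
  have hZc : ∀ a, Continuous (Zf a) := fun a => continuous_finsetSum S fun q _ => continuous_const.mul (hYqc q a)
  have hXc : ∀ a, Continuous (Xf a) := fun a => (hYqc p a).sub (hZc a)
  have iZ2 : ∀ a, Integrable (fun U => (Zf a U) ^ 2) μ := fun a => hint ((hZc a).pow 2)
  -- coefficients on the subtype
  set c : ↥S → ℝ := fun q => plaquetteCurl ωp (q : ZdPlaquette 4) with hcdef
  set p₀ : ↥S := ⟨p, hpS⟩ with hp₀def
  have hp₀coe : ((p₀ : ↥S) : ZdPlaquette 4) = p := rfl
  set Δ : ℝ := (∑ q : ↥S, c q ^ 2) - s with hΔdef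
  have hcp₀ : c p₀ = s := hcp
  have hcsq : ∑ q : ↥S, c q ^ 2 = s + Δ := by rw [hΔdef]; ring
  have hΔle : |Δ| ≤ Δb := by
    rw [hΔdef, hcdef, Finset.sum_coe_sort S (fun q => plaquetteCurl ωp q ^ 2)]
    exact hΔb
  have hcsum' : ∑ q : ↥S, |c q| ≤ Cc := by
    rw [hcdef, Finset.sum_coe_sort S (fun q => |plaquetteCurl ωp q|)]; exact hcsum
  -- sums over `S` versus sums over `↥S`
  have hZsub : ∀ a U, (∑ q : ↥S, c q * plaqField r β U (q : ZdPlaquette 4) a) = Zf a U := fun a U => by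
    rw [hZfdef, hcdef]; exact Finset.sum_coe_sort S (fun q => plaquetteCurl ωp q * plaqField r β U q a)
  -- the Stein pair
  have hA₀ : 0 < δ ^ (-(1 / 2 : ℝ)) := Real.rpow_pos_of_pos hδ _
  have hA₁ : 0 ≤ ((lieDim r : ℝ) + 2) * (1 + ∑ q : ↥S, |c q|) := by positivity
  have hpair := AssemblyPair.steinPair_core r β μ S E ωp hωE hε hSD' hW Xf Zf hXc hZc
    (fun a U => rfl) (s := s) (Δ := Δ) hδ w (fun U => rfl)
    (fun a => fun y : ↥S → Fin (lieDim r) → ℝ => (∑ q, c q * y q a) *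
      Real.exp (-(δ / 2) * ∑ b, ((y p₀ b - ∑ q, c q * y q b) ^ 2 + (∑ q, c q * y q b) ^ 2)))
    (fun a => fun y : ↥S → Fin (lieDim r) → ℝ => (y p₀ a - ∑ q, c q * y q a) *
      Real.exp (-(δ / 2) * ∑ b, ((y p₀ b - ∑ q, c q * y q b) ^ 2 + (∑ q, c q * y q b) ^ 2)))
    hA₀ hA₁ (fun a => TestFun.contDiff_gZ c p₀ δ a) (fun a y => TestFun.abs_gZ_le c p₀ δ a hδ y)
    (fun a y => TestFun.norm_fderiv_gZ_le c p₀ δ a hδ hδ1 y)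
    (fun a U => by simp only [hZsub, hwdef, hXfdef, hp₀coe])
    (fun a U => by
      rw [TestFun.fderiv_gZ_vec c p₀ δ a]
      simp only [hZsub, hcsq, hcp₀, hwdef, hXfdef, hp₀coe]
      ring)
    (fun a => TestFun.contDiff_gX c p₀ δ a) (fun a y => TestFun.abs_gX_le c p₀ δ a hδ y)
    (fun a y => TestFun.norm_fderiv_gX_le c p₀ δ a hδ hδ1 y)
    (fun a U => by simp only [hZsub, hwdef, hXfdef, hp₀coe])
    (fun a U => by
      rw [TestFun.fderiv_gX_vec c p₀ δ a]
      simp only [hZsub, hcsq, hcp₀, hwdef, hXfdef, hp₀coe]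
      ring)
  -- weaken `η_p ≤ η`
  have hηle : W * (εsd * (δ ^ (-(1 / 2 : ℝ)) + ((lieDim r : ℝ) + 2) * (1 + ∑ q : ↥S, |c q|))) + 3 * |Δ| ≤ η := by
    rw [hηdef]
    have h1 : ((lieDim r : ℝ) + 2) * (1 + ∑ q : ↥S, |c q|) ≤ ((lieDim r : ℝ) + 2) * (1 + Cc) :=
      mul_le_mul_of_nonneg_left (by linarith [hcsum']) (by positivity)
    have h2 := mul_le_mul_of_nonneg_left (add_le_add_left h1 (δ ^ (-(1 / 2 : ℝ)))) hε
    have h3 := mul_le_mul_of_nonneg_left h2 hW0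
    linarith
  have hS1 : ∀ a, |(∫ U, Zf a U * (Zf a U * w U) ∂μ) - s * ∫ U, (w U - δ * (Zf a U) ^ 2 * w U) ∂μ| ≤ η :=
    fun a => ((hpair a).1).trans hηle
  have hS2 : ∀ a, |(∫ U, Zf a U * (Xf a U * w U) ∂μ) + s * δ * ∫ U, Xf a U * Zf a U * w U ∂μ| ≤ η :=
    fun a => ((hpair a).2).trans hηle
  -- measurability and a uniform bound
  have hXm : ∀ a, Measurable (Xf a) := fun a => (hXc a).measurable
  have hZm : ∀ a, Measurable (Zf a) := fun a => (hZc a).measurable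
  obtain ⟨B₀, -, hB₀⟩ := TangentSteinFiniteBeta.exists_abs_le_of_continuous
    (continuous_finsetSum Finset.univ fun a _ => ((hXc a).abs).add ((hZc a).abs))
  have hXb : ∀ a U, |Xf a U| ≤ B₀ := fun a U => by
    refine le_trans ?_ ((le_abs_self _).trans (hB₀ U))
    exact (le_add_of_nonneg_right (abs_nonneg (Zf a U))).trans
      (Finset.single_le_sum (f := fun b => |Xf b U| + |Zf b U|) (fun b _ => by positivity) (Finset.mem_univ a))
  have hZb : ∀ a U, |Zf a U| ≤ B₀ := fun a U => by
    refine le_trans ?_ ((le_abs_self _).trans (hB₀ U))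
    exact (le_add_of_nonneg_left (abs_nonneg (Xf a U))).trans
      (Finset.single_le_sum (f := fun b => |Xf b U| + |Zf b U|) (fun b _ => by positivity) (Finset.mem_univ a))
  -- the budget in pair form
  have hbudget' : ∫ U, ∑ a, (Xf a U + Zf a U) ^ 2 ∂μ ≤ (lieDim r : ℝ) * s + εb := by
    have hV : ∀ U, ∑ a, (Xf a U + Zf a U) ^ 2 = ∑ a, (plaqField r β U p a) ^ 2 :=
      fun U => Finset.sum_congr rfl fun a _ => by rw [hXfdef]; simp only; rw [sub_add_cancel]
    simp_rw [hV]
    exact hbudget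
  -- crude moments: `E Σ_a (X_a² + Z_a²) ≤ Λ`
  have hZ2 : ∀ a, ∫ U, (Zf a U) ^ 2 ∂μ ≤ Cc ^ 2 * Y2 := by
    intro a
    have hpt : ∀ U, (Zf a U) ^ 2 ≤ Cc * ∑ q ∈ S, |plaquetteCurl ωp q| * (plaqField r β U q a) ^ 2 := fun U => by
      rw [hZfdef]
      refine (sq_sum_mul_le S _ _).trans ?_
      exact mul_le_mul_of_nonneg_right hcsum (Finset.sum_nonneg fun q _ => by positivity)
    have iq : ∀ q ∈ S, Integrable (fun U => |plaquetteCurl ωp q| * (plaqField r β U q a) ^ 2) μ :=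
      fun q hq => ((hY2 q hq a).1).const_mul _
    have iR : Integrable (fun U => Cc * ∑ q ∈ S, |plaquetteCurl ωp q| * (plaqField r β U q a) ^ 2) μ :=
      (integrable_finsetSum S iq).const_mul _
    calc ∫ U, (Zf a U) ^ 2 ∂μ ≤ ∫ U, Cc * ∑ q ∈ S, |plaquetteCurl ωp q| * (plaqField r β U q a) ^ 2 ∂μ :=
          integral_mono (iZ2 a) iR hpt
      _ = Cc * ∑ q ∈ S, |plaquetteCurl ωp q| * ∫ U, (plaqField r β U q a) ^ 2 ∂μ := by
          rw [integral_const_mul, integral_finsetSum S iq]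
          congr 1
          exact Finset.sum_congr rfl fun q _ => integral_const_mul _ _
      _ ≤ Cc * ∑ q ∈ S, |plaquetteCurl ωp q| * Y2 :=
          mul_le_mul_of_nonneg_left (Finset.sum_le_sum fun q hq =>
            mul_le_mul_of_nonneg_left (hY2 q hq a).2 (abs_nonneg _)) hCc0
      _ = Cc * ((∑ q ∈ S, |plaquetteCurl ωp q|) * Y2) := by rw [Finset.sum_mul]
      _ ≤ Cc * (Cc * Y2) := by
          have hY20 : 0 ≤ Y2 := le_trans (integral_nonneg fun U => sq_nonneg _) (hY2 p hpS a₀).2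
          exact mul_le_mul_of_nonneg_left (mul_le_mul_of_nonneg_right hcsum hY20) hCc0
      _ = Cc ^ 2 * Y2 := by ring
  have hΛ : ∫ U, ∑ a, ((Xf a U) ^ 2 + (Zf a U) ^ 2) ∂μ ≤ Λ := by
    have hpt : ∀ U, ∑ a, ((Xf a U) ^ 2 + (Zf a U) ^ 2) ≤
        ∑ a, (2 * (plaqField r β U p a) ^ 2 + 3 * (Zf a U) ^ 2) := fun U =>
      Finset.sum_le_sum fun a _ => by
        rw [hXfdef]; simp only
        nlinarith [sq_nonneg (plaqField r β U p a + Zf a U)]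
    have ia : ∀ a : Fin (lieDim r), Integrable (fun U => 2 * (plaqField r β U p a) ^ 2 + 3 * (Zf a U) ^ 2) μ :=
      fun a => (((hY2 p hpS a).1).const_mul _).add ((iZ2 a).const_mul _)
    have iR : Integrable (fun U => ∑ a, (2 * (plaqField r β U p a) ^ 2 + 3 * (Zf a U) ^ 2)) μ :=
      integrable_finsetSum Finset.univ fun a _ => ia a
    have iL : Integrable (fun U => ∑ a, ((Xf a U) ^ 2 + (Zf a U) ^ 2)) μ :=
      hint (continuous_finsetSum Finset.univ fun a _ => ((hXc a).pow 2).add ((hZc a).pow 2))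
    calc ∫ U, ∑ a, ((Xf a U) ^ 2 + (Zf a U) ^ 2) ∂μ
        ≤ ∫ U, ∑ a, (2 * (plaqField r β U p a) ^ 2 + 3 * (Zf a U) ^ 2) ∂μ := integral_mono iL iR hpt
      _ = ∑ a, (2 * ∫ U, (plaqField r β U p a) ^ 2 ∂μ + 3 * ∫ U, (Zf a U) ^ 2 ∂μ) := by
          rw [integral_finsetSum Finset.univ fun a _ => ia a]
          refine Finset.sum_congr rfl fun a _ => ?_
          rw [integral_add (((hY2 p hpS a).1).const_mul _) ((iZ2 a).const_mul _), integral_const_mul,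
            integral_const_mul]
      _ ≤ ∑ _a : Fin (lieDim r), (2 * Y2 + 3 * (Cc ^ 2 * Y2)) :=
          Finset.sum_le_sum fun a _ => add_le_add (mul_le_mul_of_nonneg_left (hY2 p hpS a).2 (by norm_num))
            (mul_le_mul_of_nonneg_left (hZ2 a) (by norm_num))
      _ = Λ := by rw [Finset.sum_const, Finset.card_univ, Fintype.card_fin, nsmul_eq_mul, hΛdef]; ring
  -- the abstract Stein-pair budget lemma
  have hA1 := SteinPair.integral_abs_le μ hXm hZm hXb hZb hs0 hδ (w := w) (fun U => rfl) hS1 hS2 hbudget' hΛ a₀ hlam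
  rw [hXfdef] at hA1
  simpa only [hZfdef, hηdef, hΛdef] using hA1

end AssemblyBackground

end Summit.QuantumFields.YangMills.Cruxes.FreeProbeLawG.SteinFree

end
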